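import Summits.AtomisticToContinuum.BoseEinsteinCondensation.Theorems.BECThomsonPrincipleDensityResponseTransportCoercive
import Summits.AtomisticToContinuum.BoseEinsteinCondensation.Theorems.BECThomsonPrincipleDensityResponseTransportVariations
import Summits.AtomisticToContinuum.BoseEinsteinCondensation.Theorems.DensityResponse.Negative.Decorations
import Mathlib.Analysis.Calculus.LocalExtr.Basic

/-!
# Route `BECThomsonPrinciple`, crux `DensityResponse` (stmt-AtomisticToContinuum-9481),
# line `force-balance-constitutive` — stub S1 `stub_transportStationary` (transport-stationarity)

The registered stub S1 `TransportStationary` of the skeleton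
`Cruxes/DensityResponse/Lines/force-balance-constitutive.lean`: for a BOUNDED admissible pair potential
`w`, `L > 0`, a mode `n ≠ 0`, a drive `s ≥ 0` and a finite-energy periodic state `Φ` there is a
finite-energy state `Φ'` with no larger driven energy than the better-signed translate of `Φ`,
`E_w(Φ') − s·m(Φ') ≤ E_w(Φ) − s·|m(Φ)|`, which is TRANSPORT-STATIONARY, `P_k(Φ') = s·N_eff(Φ')`
(`stressWave = s·effNumber`).

Proof (the assembly of the sub-goals landed for this line): (0) `N = 0` is trivial (all waves vanish);
(1) a half-wavelength translate `Φ₀` of `Φ` has the same energy and `m(Φ₀) = |m(Φ)|`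
(`exists_translate_source_neg`); (2) along the transported family `Φ₀^τ = Φ₀.transport hL hn τ`
(`…TransportedState`) the driven energy `f(τ) = T(Φ₀^τ) + V_w(Φ₀^τ) − s·m(Φ₀^τ)` is differentiable
with `f′(τ) = −P_k(Φ₀^τ) + s·N_eff(Φ₀^τ)` by the three first-variation theorems
`hasDerivAt_kinetic_transport` (`…KineticVariation`), `hasDerivAt_interaction_transport`,
`hasDerivAt_sourceMean_transport` (`…TransportVariations`) and `stressWave = K + (|k|²/4)m + I`;
(3) `f → +∞` in both time directions by coercivity of the kinetic energy
(`tendsto_cellKineticEnergy_transportFun_atTop/atBot`, `…TransportCoercive`), `V_w ≥ 0` and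
`|m| ≤ 2N`; (4) hence `f` attains its minimum over a compact interval at an INTERIOR point `τ₀`
(`IsCompact.exists_isMinOn`), where `f′(τ₀) = 0` (`IsLocalMin.hasDerivAt_eq_zero`), i.e.
`P_k = s·N_eff`, and `f(τ₀) ≤ f(0) = E_w(Φ) − s|m(Φ)|`. `n ≠ 0` is load-bearing (Disproof (a)): it
makes `|k|² ≠ 0` in the transport and the coercivity.
-/

namespace Summit.AtomisticToContinuum.BoseEinsteinCondensation.Cruxes.DensityResponse.ForceBalanceConstitutive

noncomputable section

open MeasureTheory Filter Set Real
open scoped ENNReal Topology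
open Literature.MathematicalPhysics.QuantumManyBody.BoseGas
open Summit.AtomisticToContinuum.BoseEinsteinCondensation.Theorems.DensityResponse.Negative
  (exists_translate_source_neg)

variable {N : ℕ} {L : ℝ}

/-- **Real splitting of the periodic energy under a bounded interaction**: for an admissible state
`Ψ` and `W = ∑ w^per ≤ C` everywhere, `E_w(Ψ) = ofReal (T_L(Ψ) + ∫ W|Ψ|²)` with the real kinetic
energy `cellKineticEnergy` and the real Bochner interaction integral. [folklore] -/
theorem periodicEnergy_eq_ofReal_kinetic_add_interaction {w : ℝ → ℝ≥0∞} (hwm : Measurable w)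
    {C : ℝ} (hC0 : 0 ≤ C) (hC : ∀ X : Config N, periodicInteraction w L X ≤ ENNReal.ofReal C)
    (Ψ : PeriodicTrialState N L) :
    periodicEnergy w Ψ = ENNReal.ofReal (cellKineticEnergy L Ψ.ψ +
      ∫ X in cellN N L, (periodicInteraction w L X).toReal * ‖Ψ.ψ X‖ ^ 2) := by
  have hkin : ∀ X, kineticDensity Ψ.ψ X = ENNReal.ofReal (kineticDensityReal Ψ.ψ X) :=
    kineticDensity_eq_ofReal Ψ.ψ
  have hmeas : AEMeasurable (fun X => periodicInteraction w L X * (‖Ψ.ψ X‖₊ : ℝ≥0∞) ^ 2)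
      (volume.restrict (cellN N L)) :=
    ((measurable_periodicInteraction_cfg hwm L).mul
      (Ψ.contDiff.continuous.measurable.nnnorm.coe_nnreal_ennreal.pow_const 2)).aemeasurable
  have hint : IntegrableOn (fun X => (periodicInteraction w L X).toReal * ‖Ψ.ψ X‖ ^ 2) (cellN N L) :=
    integrableOn_toReal_interaction_mul_of_le hwm hC0 hC ((Ψ.contDiff.continuous.norm).pow 2)
  have hpot : ∫⁻ X in cellN N L, periodicInteraction w L X * (‖Ψ.ψ X‖₊ : ℝ≥0∞) ^ 2 =
      ENNReal.ofReal (∫ X in cellN N L, (periodicInteraction w L X).toReal * ‖Ψ.ψ X‖ ^ 2) := by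
    rw [ofReal_integral_eq_lintegral_ofReal hint
      (ae_of_all _ fun X => mul_nonneg ENNReal.toReal_nonneg (sq_nonneg _))]
    refine lintegral_congr fun X => ?_
    rw [ENNReal.ofReal_mul ENNReal.toReal_nonneg,
      ENNReal.ofReal_toReal (ne_top_of_le_ne_top ENNReal.ofReal_ne_top (hC X)),
      coe_nnnorm_sq_eq_ofReal]
  unfold periodicEnergy
  rw [lintegral_add_right' _ hmeas, lintegral_kineticDensity_eq Ψ.contDiff L, hpot,
    ← ENNReal.ofReal_add (cellKineticEnergy_nonneg L Ψ.ψ)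
      (integral_nonneg fun X => mul_nonneg ENNReal.toReal_nonneg (sq_nonneg _))]

/-- For `N = 0` every state is transport-stationary: all four waves vanish. [folklore] -/
theorem stressWave_eq_of_zero {L : ℝ} (w : ℝ → ℝ≥0∞) (n : Fin 3 → ℤ) (s : ℝ) (Φ : PeriodicTrialState 0 L) :
    stressWave w n Φ = s * effNumber n Φ := by
  simp [stressWave, kineticStressWave, sourceMean, virialWave, effNumber]

/-- For `N = 0` the density wave vanishes. [folklore] -/
theorem sourceMean_eq_zero_of_zero {L : ℝ} (n : Fin 3 → ℤ) (Φ : PeriodicTrialState 0 L) :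
    sourceMean n Φ = 0 := by
  simp [sourceMean]

/-- **Stub S1 `stub_transportStationary`** (registered on stmt-AtomisticToContinuum-9481): the
transport-stationarity normal form — every finite-energy periodic state under a bounded admissible
pair potential can be replaced, at no cost in the driven energy `E_w − s·m` (compared with its
better-signed half-wavelength translate), by a TRANSPORT-STATIONARY state `P_k(Φ') = s·N_eff(Φ')`,
namely the transported state `Φ₀^τ₀` at a minimiser `τ₀` of the driven energy along the flow of the
density-wave displacement field `u_k = k sin(k·x)/|k|²`. [folklore] -/
theorem stub_transportStationary : TransportStationary := by
  intro N L w hw hwb hL n hn s hs Φ hE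
  obtain ⟨B, hB⟩ := hwb
  obtain ⟨C, hC0, hC⟩ := exists_periodicInteraction_le_ofReal hw hB hL N
  rcases Nat.eq_zero_or_pos N with hN0 | hNpos
  · subst hN0
    refine ⟨Φ, hE, ?_, stressWave_eq_of_zero w n s Φ⟩
    rw [sourceMean_eq_zero_of_zero, abs_zero]
  have hN : 1 ≤ N := hNpos
  -- Step 1: sign of the density wave
  obtain ⟨Φ₀, hE₀, hm₀⟩ : ∃ Φ₀ : PeriodicTrialState N L,
      periodicEnergy w Φ₀ = periodicEnergy w Φ ∧ sourceMean n Φ₀ = |sourceMean n Φ| := by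
    rcases le_or_gt 0 (sourceMean n Φ) with h | h
    · exact ⟨Φ, rfl, (abs_of_nonneg h).symm⟩
    · obtain ⟨Ψ, hΨE, hΨm⟩ := exists_translate_source_neg hL hn Φ
      refine ⟨Ψ, hΨE w, ?_⟩
      rw [abs_of_neg h]
      exact hΨm
  -- Step 2: the driven energy along the transported family and its derivative
  set T : ℝ → ℝ := fun t => cellKineticEnergy L (transportFun L n t Φ₀.ψ) with hT
  set V : ℝ → ℝ := fun t => ∫ X in cellN N L,
    (periodicInteraction w L X).toReal * ‖transportFun L n t Φ₀.ψ X‖ ^ 2 with hV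
  set M : ℝ → ℝ := fun t => sourceMean n (Φ₀.transport hL hn t) with hM
  set f : ℝ → ℝ := fun t => T t + V t - s * M t with hf
  have hEt : ∀ t, periodicEnergy w (Φ₀.transport hL hn t) = ENNReal.ofReal (T t + V t) := fun t =>
    periodicEnergy_eq_ofReal_kinetic_add_interaction hw.1 hC0 hC (Φ₀.transport hL hn t)
  have hV0 : ∀ t, 0 ≤ V t := fun t =>
    integral_nonneg fun X => mul_nonneg ENNReal.toReal_nonneg (sq_nonneg _)
  have hT0 : ∀ t, 0 ≤ T t := fun t => cellKineticEnergy_nonneg L _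
  have hEt' : ∀ t, (periodicEnergy w (Φ₀.transport hL hn t)).toReal = T t + V t := fun t => by
    rw [hEt, ENNReal.toReal_ofReal (add_nonneg (hT0 t) (hV0 t))]
  have hderiv : ∀ t, HasDerivAt f
      (-(stressWave w n (Φ₀.transport hL hn t)) + s * effNumber n (Φ₀.transport hL hn t)) t := by
    intro t
    have h1 := hasDerivAt_kinetic_transport hL hn Φ₀ t
    have h2 := hasDerivAt_interaction_transport hw hB hL hn Φ₀ t
    have h3 := (hasDerivAt_sourceMean_transport hL hn Φ₀ t).const_mul s
    have h := (h1.add h2).sub h3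
    have hfg : f = fun x => ((∫ X in cellN N L, kineticDensityReal (transportFun L n x Φ₀.ψ) X) +
        ∫ X in cellN N L, (periodicInteraction w L X).toReal * ‖transportFun L n x Φ₀.ψ X‖ ^ 2) -
        s * sourceMean n (Φ₀.transport hL hn x) := rfl
    rw [hfg]
    refine h.congr_deriv ?_
    simp only [stressWave]
    ring
  have hfc : Continuous f := continuous_iff_continuousAt.2 fun t => (hderiv t).continuousAt
  -- Step 3: coercivity
  have hMle : ∀ t, s * M t ≤ s * (2 * N) := fun t =>
    mul_le_mul_of_nonneg_left ((le_abs_self _).trans (abs_sourceMean_le n _)) hs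
  have hflb : ∀ t, T t + -(s * (2 * N)) ≤ f t := fun t => by
    simp only [hf]; linarith [hV0 t, hMle t]
  have hftop : Tendsto f atTop atTop :=
    tendsto_atTop_mono hflb (tendsto_atTop_add_const_right _ _
      (tendsto_cellKineticEnergy_transportFun_atTop hL hn hN Φ₀))
  have hfbot : Tendsto f atBot atTop :=
    tendsto_atTop_mono hflb (tendsto_atTop_add_const_right _ _
      (tendsto_cellKineticEnergy_transportFun_atBot hL hn hN Φ₀))
  obtain ⟨T₁, hT₁⟩ := eventually_atTop.1 (hftop.eventually (eventually_gt_atTop (f 0)))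
  obtain ⟨T₂, hT₂⟩ := eventually_atBot.1 (hfbot.eventually (eventually_gt_atTop (f 0)))
  have hT₁pos : 0 < T₁ := by
    by_contra h
    exact lt_irrefl _ (hT₁ 0 (not_lt.1 h))
  have hT₂neg : T₂ < 0 := by
    by_contra h
    exact lt_irrefl _ (hT₂ 0 (not_lt.1 h))
  -- Step 4: an interior minimiser
  obtain ⟨τ₀, hτ₀mem, hτ₀min⟩ := (isCompact_Icc : IsCompact (Icc T₂ T₁)).exists_isMinOn
    (nonempty_Icc.2 (by linarith)) hfc.continuousOn
  have hf0 : f τ₀ ≤ f 0 := hτ₀min ⟨hT₂neg.le, hT₁pos.le⟩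
  have hlt₁ : τ₀ < T₁ := by
    by_contra h
    linarith [hT₁ τ₀ (not_lt.1 h)]
  have hlt₂ : T₂ < τ₀ := by
    by_contra h
    linarith [hT₂ τ₀ (not_lt.1 h)]
  have hloc : IsLocalMin f τ₀ := hτ₀min.isLocalMin (Icc_mem_nhds hlt₂ hlt₁)
  have hzero := hloc.hasDerivAt_eq_zero (hderiv τ₀)
  -- Step 5: the transport-stationary state
  refine ⟨Φ₀.transport hL hn τ₀, ?_, ?_, ?_⟩
  · rw [hEt]; exact ENNReal.ofReal_ne_top
  · have h0 : f 0 = (periodicEnergy w Φ).toReal - s * |sourceMean n Φ| := by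
      have : f 0 = T 0 + V 0 - s * M 0 := rfl
      rw [this, ← hEt' 0, hM]
      simp only [PeriodicTrialState.transport_zero, hE₀, hm₀]
    have h1 : (periodicEnergy w (Φ₀.transport hL hn τ₀)).toReal -
        s * sourceMean n (Φ₀.transport hL hn τ₀) = f τ₀ := by
      rw [hEt']
    rw [h1, ← h0]
    exact hf0
  · linarith

end

end Summit.AtomisticToContinuum.BoseEinsteinCondensation.Cruxes.DensityResponse.ForceBalanceConstitutive
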